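import Literature.Geometry.Lorentzian.BondiBartnikGap
import Literature.Geometry.Lorentzian.SoundNearKerrLeaf
import Literature.Geometry.Lorentzian.CausalFutureProofs
import Literature.Geometry.Lorentzian.DeviationTolerance
import Literature.Geometry.Lorentzian.NearKerrLeafMinkowskiBoostedDodge
import HarnessLib

/-!
# Scratch (worker of lead a2, stub `stub_probeSector`): the honest route as named facts, and the
# registered signature proved MODULO them (sorry-free conditional theorems + bookkeeping lemmas).

Not a landing candidate: the facts below are route-posited OPEN statements (`def … : Prop`), none is in
print as stated; see `work/stubs/stub_probeSector.report.md`.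
-/

noncomputable section

set_option linter.dupNamespace false

open Set Filter Function Topology TopologicalSpace
open Literature.Geometry.Lorentzian
open scoped Manifold ContDiff Topology ENNReal

namespace Summit.FinalStateConjecture.FinalStateConjecture.Theorems.BondiBartnikRigidity.DirectMethod

namespace ProbeSectorFacts

/-! ### The five candidate facts -/

/-- **B1 — the Bondi–Bartnik infimum of a point is zero** (verbatim `stub_probeBartnikMassZero` of the
dead line `hyperboloidal-mass-pinches-flat`).  On an MGHD of admissible vacuum data a point
`p ∈ J⁺(ι X)` has competitors (`IsCompetitorMass`) of arbitrarily small cut energy.  Ingredients in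
print, each for its own setting: Bartnik's quasi-local mass and its smallness on small regions
(Bartnik 1989; ICM 2002, Def. 4), extension of small data on a ball to AF vacuum data (Czimek 2017),
far-field gluing (Corvino 2000; Corvino–Schoen 2006), `M(u) ≤ M_ADM` at every cut of a
Christodoulou–Klainerman development (CK 1993, Ch. 17, Conclusion 17.0.4).  NOT in print as stated
(the transplant to the competitor class of `BondiBartnikGap.lean`).  MISSING in tree.
[conjecture] [cite: Bartnik2002ICM, Def. 4] -/
def ProbeBartnikMassZero : Prop :=
  ∀ (X : Type) [TopologicalSpace X] [ChartedSpace E3 X] [IsManifold (𝓡 3) ∞ X]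
    [T2Space X] [SecondCountableTopology X] [ConnectedSpace X],
  ∀ D ∈ admissibleVacuumData X, ∀ (𝒟 : VacuumCauchyDevelopment D) (p : 𝒟.carrier),
  𝒟.IsMaximal → p ∈ 𝒟.metric.causalFuture 𝒟.timeOrientation (range 𝒟.embed) →
  ∀ η : ℝ, 0 < η → ∃ m' : ℝ, 𝒟.IsCompetitorMass ({p} : Set 𝒟.carrier) m' ∧ m' ≤ η

/-- **F3 — the escape window** (verbatim `stub_escapeWindowLeaf` of the dead line): below the honesty
threshold, a `(Λ, k')`-leaf `S ∋ p` without holes in an MGHD whose cone cut at `p` has an energy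
`≤ γ` is followed INSIDE `J⁺({p})` by an honest bounded-geometry `(Λ₁, k₁)`-leaf, `Λ₁ < 1`.  Semi-global
evolution past large escaping content near `𝓘⁺`; no printed theorem (Klainerman–Nicolò 2003 need
weighted smallness on the exterior of a ball of the DATA).  MISSING.
[conjecture] [cite: KlainermanNicolo2003, Ch. 3, main theorem (exterior stability; weighted-small data outside a ball only)] -/
def EscapeWindowLeaf : Prop :=
  ∀ (k₁ : ℕ), ∃ k' : ℕ, ∀ Λ : ℝ≥0∞, Λ < 1 →
    ∃ (Λ₁ : ℝ≥0∞) (γ : ℝ), Λ₁ < 1 ∧ 0 < γ ∧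
    ∀ (X : Type) [TopologicalSpace X] [ChartedSpace E3 X] [IsManifold (𝓡 3) ∞ X]
      [T2Space X] [SecondCountableTopology X] [ConnectedSpace X],
    ∀ D ∈ admissibleVacuumData X, ∀ (𝒟 : VacuumCauchyDevelopment D) (M a : Fin 0 → ℝ)
      (S : Set 𝒟.carrier) (p : 𝒟.carrier) (m : ℝ),
    𝒟.IsMaximal → 𝒟.toCauchyDevelopment.IsNearKerrLeaf k' Λ 0 M a S → p ∈ S →
    𝒟.toCauchyDevelopment.HasCutBondiMass ({p} : Set 𝒟.carrier) m → m ≤ γ →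
    ∃ S₁ : Set 𝒟.carrier, 𝒟.toCauchyDevelopment.IsNearKerrLeaf k₁ Λ₁ 0 M a S₁ ∧
      S₁ ⊆ 𝒟.metric.causalFuture 𝒟.timeOrientation ({p} : Set 𝒟.carrier)

/-- **B2 — small cut energy pinches an honest hyperboloid flat** (verbatim
`stub_hyperboloidalMassPinchesFlat` of the dead line): an honest `(Λ₁, k₁)`-leaf `S₁ ⊆ J⁺({p})` without
holes plus a cut energy `m ≤ γ(k, ε, Λ₁)` of `p`'s cone yields an `(ε, k)`-flat leaf in `J⁺(S₁)`.  A
quantitative positive-Bondi-mass ALMOST-RIGIDITY in `Cᵏ` under a unit-scale `C^{k₁}` bound: not in print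
(positivity: Schoen–Yau / Ludvigsen–Vickers / Horowitz–Perry 1982; rigidity at zero mass:
Chruściel–Jezierski–Łęski 2004 (hyperboloidal), Chruściel–Paetz arXiv:1401.3789 (light cones); ADM
almost-rigidity only in weak topologies, Dong–Song 2024; mass formula, Hirsch–Kazaras–Khuri 2022).
MISSING. [conjecture] [cite: DongSong2024, main theorem (ADM mass, pointed measured GH topology only)] -/
def HyperboloidalMassPinchesFlat : Prop :=
  ∀ (k : ℕ) (ε : ℝ≥0∞), 0 < ε → ∃ k₁ : ℕ,
    ∀ Λ₁ : ℝ≥0∞, Λ₁ < 1 → ∃ γ : ℝ, 0 < γ ∧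
    ∀ (X : Type) [TopologicalSpace X] [ChartedSpace E3 X] [IsManifold (𝓡 3) ∞ X]
      [T2Space X] [SecondCountableTopology X] [ConnectedSpace X],
    ∀ D ∈ admissibleVacuumData X, ∀ (𝒟 : VacuumCauchyDevelopment D) (M a : Fin 0 → ℝ)
      (S₁ : Set 𝒟.carrier) (p : 𝒟.carrier) (m : ℝ),
    𝒟.IsMaximal → 𝒟.toCauchyDevelopment.IsNearKerrLeaf k₁ Λ₁ 0 M a S₁ →
    S₁ ⊆ 𝒟.metric.causalFuture 𝒟.timeOrientation ({p} : Set 𝒟.carrier) →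
    𝒟.toCauchyDevelopment.HasCutBondiMass ({p} : Set 𝒟.carrier) m → m ≤ γ →
    ∃ S' : Set 𝒟.carrier, 𝒟.toCauchyDevelopment.IsNearKerrLeaf k ε 0 M a S' ∧
      S' ⊆ 𝒟.metric.causalFuture 𝒟.timeOrientation S₁

/-- **F_far′ (recommended ONE residual besides B1) — small cone energy pinches flat, SOUND form**: the
composition F3 ∘ B2 with the hypothesis leaf KEPT (`k'` chosen after `(k, ε)`, multiplicative derivative
loss) and the conclusion leaf SOUND (`IsSoundNearKerrLeaf`: layer certification + achronal sheet, so
not dodge-satisfiable; sound ⇒ typed).  A large-data semi-global stability-of-Minkowski statement near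
`𝓘⁺` inside `J⁺(p)` driven by smallness of the Bondi energy of the cut of `C⁺(p)`.  In print only:
Christodoulou–Klainerman 1993, Thm. 1.0.2 and Ch. 17 (small AF Cauchy data: global closeness,
`M(u) → 0`), Klainerman–Nicolò 2003 (exterior of large AF data, `u ≤ u₀`), Bieri 2010 (weaker decay),
Chruściel–Paetz arXiv:1401.3789 p. 4 (`m_TB = 0` on a light cone ⇒ flat to its future: the `ε = 0`
endpoint).  NOT in print: anything reaching `J⁺(p)` of an interior point of a large-data MGHD.  MISSING.
[conjecture] [cite: ChristodoulouKlainerman1993PMS41, Thm. 1.0.2 and Ch. 17, Conclusion 17.0.4] -/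
def ConeEnergyPinchesFlatSound : Prop :=
  ∀ (k : ℕ) (ε : ℝ≥0∞), 0 < ε → ∃ k' : ℕ, ∀ Λ : ℝ≥0∞, Λ < 1 → ∃ γ : ℝ, 0 < γ ∧
    ∀ (X : Type) [TopologicalSpace X] [ChartedSpace E3 X] [IsManifold (𝓡 3) ∞ X]
      [T2Space X] [SecondCountableTopology X] [ConnectedSpace X],
    ∀ D ∈ admissibleVacuumData X, ∀ (𝒟 : VacuumCauchyDevelopment D) (M a : Fin 0 → ℝ)
      (S : Set 𝒟.carrier) (p : 𝒟.carrier) (m : ℝ),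
    𝒟.IsMaximal → 𝒟.toCauchyDevelopment.IsNearKerrLeaf k' Λ 0 M a S → p ∈ S →
    𝒟.toCauchyDevelopment.HasCutBondiMass ({p} : Set 𝒟.carrier) m → m ≤ γ →
    ∃ S' : Set 𝒟.carrier, 𝒟.toCauchyDevelopment.IsSoundNearKerrLeaf k ε 0 M a S' ∧
      S' ⊆ 𝒟.metric.causalFuture 𝒟.timeOrientation ({p} : Set 𝒟.carrier)

/-- **F_far⁰ (the leaf-free form — recorded, NOT recommended)**: "inside `J⁺(p)` of any point `p` of a
maximal development of admissible data whose cone cut has a Bondi energy `≤ γ(ε, k)` there is a typed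
`(ε, k)`-near-Kerr leaf with `0` holes".  As TYPED it is junk-true on paper wherever `J⁺(p)` contains a
weakly curved far zone (dodging leaves, `Minkowski.exists_isNearKerrLeaf_subset_causalFuture_forall_dist_lt`
and DODGE-c2 §1) and Lean-inaccessible for an abstract MGHD; read HONESTLY (achronal leaf) it is FALSE
on paper (witness W3 of `Lines/hyperboloidal-mass-pinches-flat-dead.md` §3: a dilute incoming short
pulse collapsing inside `J⁺(p)` right after `C⁺(p)` has passed — the hypothesis leaf of F_far′ with
`k' ≫ k` is exactly what forbids this).  [conjecture] [folklore] -/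
def SmallConeEnergyFlatLeaf : Prop :=
  ∀ (k : ℕ) (ε : ℝ≥0∞), 0 < ε → ∃ γ : ℝ, 0 < γ ∧
    ∀ (X : Type) [TopologicalSpace X] [ChartedSpace E3 X] [IsManifold (𝓡 3) ∞ X]
      [T2Space X] [SecondCountableTopology X] [ConnectedSpace X],
    ∀ D ∈ admissibleVacuumData X, ∀ (𝒟 : VacuumCauchyDevelopment D) (M a : Fin 0 → ℝ)
      (p : 𝒟.carrier) (m : ℝ),
    𝒟.IsMaximal → p ∈ 𝒟.metric.causalFuture 𝒟.timeOrientation (range 𝒟.embed) →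
    𝒟.toCauchyDevelopment.HasCutBondiMass ({p} : Set 𝒟.carrier) m → m ≤ γ →
    ∃ S' : Set 𝒟.carrier, 𝒟.toCauchyDevelopment.IsNearKerrLeaf k ε 0 M a S' ∧
      S' ⊆ 𝒟.metric.causalFuture 𝒟.timeOrientation ({p} : Set 𝒟.carrier)

/-! ### Bookkeeping lemmas (sorry-free) -/

section Bookkeeping

variable {X : Type} [TopologicalSpace X] [ChartedSpace E3 X] [IsManifold (𝓡 3) ∞ X]
  [ConnectedSpace X] {D : InitialDataSet (𝓡 3) X}

/-- `J⁺({p}) ⊆ J⁺(S)` for `p ∈ S` (`causalFuture_mono`). [folklore] -/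
theorem causalFuture_singleton_subset (𝒟 : VacuumCauchyDevelopment D) {S : Set 𝒟.carrier}
    {p : 𝒟.carrier} (hp : p ∈ S) :
    𝒟.metric.causalFuture 𝒟.timeOrientation ({p} : Set 𝒟.carrier) ⊆
      𝒟.metric.causalFuture 𝒟.timeOrientation S :=
  LorentzianMetric.causalFuture_mono (singleton_subset_iff.2 hp)

/-- `S' ⊆ J⁺({p}) → p ∈ S → S' ⊆ J⁺(S)`. [folklore] -/
theorem subset_causalFuture_of_subset_causalFuture_singleton (𝒟 : VacuumCauchyDevelopment D)
    {S S' : Set 𝒟.carrier} {p : 𝒟.carrier}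
    (h : S' ⊆ 𝒟.metric.causalFuture 𝒟.timeOrientation ({p} : Set 𝒟.carrier)) (hp : p ∈ S) :
    S' ⊆ 𝒟.metric.causalFuture 𝒟.timeOrientation S :=
  h.trans (causalFuture_singleton_subset 𝒟 hp)

/-- `S' ⊆ J⁺(S₁) → S₁ ⊆ J⁺({p}) → p ∈ S → S' ⊆ J⁺(S)`, through `J⁺(J⁺{p}) = J⁺{p}`
(`causalFuture_causalFuture_eq`). [folklore] -/
theorem subset_causalFuture_of_two_steps (𝒟 : VacuumCauchyDevelopment D)
    {S S₁ S' : Set 𝒟.carrier} {p : 𝒟.carrier}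
    (h' : S' ⊆ 𝒟.metric.causalFuture 𝒟.timeOrientation S₁)
    (h₁ : S₁ ⊆ 𝒟.metric.causalFuture 𝒟.timeOrientation ({p} : Set 𝒟.carrier)) (hp : p ∈ S) :
    S' ⊆ 𝒟.metric.causalFuture 𝒟.timeOrientation S := by
  refine h'.trans ((LorentzianMetric.causalFuture_mono h₁).trans ?_)
  rw [LorentzianMetric.causalFuture_causalFuture_eq (WithTop.coe_le_coe.mpr le_top)
    ({p} : Set 𝒟.carrier)]
  exact causalFuture_singleton_subset 𝒟 hp

/-- **Gap + cheap competitors ⇒ small own cut energy**: if the core `{p}` has competitor masses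
`≤ η` for every `η > 0` and its Bondi–Bartnik gap is `≤ γ`, then for every `η > 0` its own cone cut has
an energy `≤ γ + η` (`bondiBartnikGapLE_iff` with `η/2` twice). [folklore] -/
theorem exists_hasCutBondiMass_le_of_gap (𝒟 : VacuumCauchyDevelopment D) {p : 𝒟.carrier} {γ : ℝ}
    (hcheap : ∀ η : ℝ, 0 < η → ∃ m' : ℝ, 𝒟.IsCompetitorMass ({p} : Set 𝒟.carrier) m' ∧ m' ≤ η)
    (hgap : 𝒟.BondiBartnikGapLE ({p} : Set 𝒟.carrier) γ) {η : ℝ} (hη : 0 < η) :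
    ∃ m : ℝ, 𝒟.toCauchyDevelopment.HasCutBondiMass ({p} : Set 𝒟.carrier) m ∧ m ≤ γ + η := by
  obtain ⟨m', hm', hm'le⟩ := hcheap (η / 2) (by positivity)
  obtain ⟨m, hm, hmle⟩ :=
    (VacuumCauchyDevelopment.bondiBartnikGapLE_iff.1 hgap) m' hm' (η / 2) (by positivity)
  exact ⟨m, hm, by linarith⟩

/-- **The self-competitor is idle** (audit item (a)): for an MGHD of admissible data, the gap clause
applied to the identity competitor and an own cut energy `m₀` returns an own cut energy `≤ m₀ + γ + η`,
which `m₀` itself witnesses whenever `0 ≤ γ` — no information. [folklore] -/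
theorem gap_self_idle (𝒟 : VacuumCauchyDevelopment D) {p : 𝒟.carrier} {γ m₀ : ℝ} (hγ : 0 ≤ γ)
    (hm₀ : 𝒟.toCauchyDevelopment.HasCutBondiMass ({p} : Set 𝒟.carrier) m₀) {η : ℝ} (hη : 0 < η) :
    ∃ m : ℝ, 𝒟.toCauchyDevelopment.HasCutBondiMass ({p} : Set 𝒟.carrier) m ∧ m ≤ m₀ + γ + η :=
  ⟨m₀, hm₀, by linarith⟩

end Bookkeeping

/-! ### What the hypothesis leaf gives and what the conclusion leaf demands at `N = 0` -/

section ZeroHoles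

variable {X : Type} [TopologicalSpace X] [ChartedSpace E3 X] [IsManifold (𝓡 3) ∞ X]
  [ConnectedSpace X] {D : InitialDataSet (𝓡 3) X}

/-- **`N = 0` unfolding of `IsNearKerrLeaf`** (audit item (a)): a near-Kerr leaf WITHOUT holes is
exactly a flat chart `Ψ₀` on some `U₀ ⊇ {t₀ > −1}` which is smooth on, and an open embedding of, the
WHOLE layer `L₀ = {−1 < t₀ < 1}` into `J⁺(ι X)`, whose `Cᵏ` deviation from `η` on the WHOLE sheet
`{t₀ = 0}` is `≤ ε`, with `S = Ψ₀({t₀ = 0})`, the upper layer in `I⁺(S)` and the barrier clause; all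
hole clauses quantify over `Fin 0`.  (So the hypothesis hands Lean the metric `Ψ₀^* g` only through its
`k'`-jet along the sheet, within `Λ`; and the conclusion asks for such a chart with `ε` in place of
`Λ`.) [folklore] -/
theorem isNearKerrLeaf_zero_iff (𝒟 : CauchyDevelopment D) (k : ℕ) (ε : ℝ≥0∞) (M a : Fin 0 → ℝ)
    (S : Set 𝒟.carrier) :
    𝒟.IsNearKerrLeaf k ε 0 M a S ↔
      ∃ (U₀ : Opens E4) (Ψ₀ : (hypBackground U₀).domain → 𝒟.carrier),
        {x : E4 | -1 < x 0 - Real.sqrt (1 + E4.spatialNorm x ^ 2)} ⊆ (U₀ : Set E4) ∧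
        ContMDiffOn 𝓘(ℝ, E4) (𝓡 4) ∞ Ψ₀
          {x | -1 < (hypBackground U₀).time x.1 ∧ (hypBackground U₀).time x.1 < 1} ∧
        IsOpenEmbedding
          ({x | -1 < (hypBackground U₀).time x.1 ∧ (hypBackground U₀).time x.1 < 1}.restrict Ψ₀) ∧
        Ψ₀ '' {x | -1 < (hypBackground U₀).time x.1 ∧ (hypBackground U₀).time x.1 < 1} ⊆
          𝒟.metric.causalFuture 𝒟.timeOrientation (range 𝒟.embed) ∧
        𝒟.toSpacetime.deviationCk (hypBackground U₀) Ψ₀ k 0 ≤ ε ∧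
        S = Ψ₀ '' (hypBackground U₀).timeSlab 0 ∧
        Ψ₀ '' {x | 0 < (hypBackground U₀).time x.1 ∧ (hypBackground U₀).time x.1 < 1} ⊆
          𝒟.metric.chronologicalFuture 𝒟.timeOrientation S ∧
        𝒟.exteriorOf (Ψ₀ '' {x | 0 < (hypBackground U₀).time x.1 ∧ (hypBackground U₀).time x.1 < 1}) \
            Ψ₀ '' {x | 0 < (hypBackground U₀).time x.1 ∧ (hypBackground U₀).time x.1 < 1} ⊆
          𝒟.metric.causalPast 𝒟.timeOrientation S := by
  constructor
  · rintro ⟨R, ρ, mo, r, B, U₀, B₀, Ψ, Ψ₀, L, W, L₀, W₀, -, -, hB₀, -, hL₀, hW₀, -, hU₀, -, hΨ₀,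
      hΨ₀e, hΨ₀J, -, hdev₀, -, -, -, hS, hWI, hbar⟩
    subst hB₀ hL₀ hW₀
    simp only [Set.iUnion_of_empty, Set.union_empty] at hS hWI hbar
    exact ⟨U₀, Ψ₀, fun x hx => hU₀ ⟨hx, fun i => i.elim0⟩, hΨ₀, hΨ₀e, hΨ₀J, hdev₀, hS, hWI, hbar⟩
  · rintro ⟨U₀, Ψ₀, hU₀, hΨ₀, hΨ₀e, hΨ₀J, hdev₀, hS, hWI, hbar⟩
    refine ⟨Fin.elim0, Fin.elim0, Fin.elim0, Fin.elim0, Fin.elim0, U₀, hypBackground U₀,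
      fun i => i.elim0, Ψ₀, fun i => i.elim0, fun i => i.elim0, _, _, fun i => i.elim0,
      fun i => i.elim0, rfl, fun i => i.elim0, rfl, rfl, fun i => i.elim0,
      fun x hx => hU₀ hx.1, fun i => i.elim0, hΨ₀, hΨ₀e, hΨ₀J, fun i => i.elim0, hdev₀,
      fun i => i.elim0, fun i => i.elim0, fun i => i.elim0, ?_, ?_, ?_⟩
    · simpa only [Set.iUnion_of_empty, Set.union_empty] using hS
    · simpa only [Set.iUnion_of_empty, Set.union_empty] using hWI
    · simpa only [Set.iUnion_of_empty, Set.union_empty] using hbar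

/-- **Unit scale is forced below the threshold** (audit item (a): no "collapsed chart" escape for
`ε < 1`): if the flat chart of a `0`-hole `(ε, k)`-leaf has `deviationCk ≤ ε < 1`, then at every sheet
point `dΨ₀` maps each spatial coordinate vector `v` (`v⁰ = 0`) to a `g`-spacelike vector with
`g(dΨ₀ v, dΨ₀ v) ≥ (1 − ε) ‖v‖²` (`le_pullback_of_apply_zero_eq_zero`, `DeviationTolerance`), so the sheet
contains an honest spacelike quasi-isometric copy of the hyperbolic ball of coordinate radius
`< √((ε⁻¹ − 1)/2)` about the tip (where `η(v, v) ≥ ‖v‖²/(1 + 2r²) > ε ‖v‖²` on `T H`).  Restated here for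
the probe sector's binders `ε < Λ < 1`. [folklore] -/
theorem unit_scale_forced {𝓢 : Spacetime.{0} 4} {U₀ : Opens E4}
    (Ψ₀ : (hypBackground U₀).domain → 𝓢.carrier) (k : ℕ) {ε Λ : ℝ≥0∞} (hεΛ : ε < Λ) (hΛ : Λ < 1)
    (hdev : 𝓢.deviationCk (hypBackground U₀) Ψ₀ k 0 ≤ ε) {x : (hypBackground U₀).domain}
    (hx : x ∈ (hypBackground U₀).timeSlab 0) {v : E4} (hv : v 0 = 0) :
    (1 - ε.toReal) * ‖v‖ ^ 2 ≤
      𝓢.metric.val (Ψ₀ x) (mfderiv 𝓘(ℝ, E4) (𝓡 4) Ψ₀ x v) (mfderiv 𝓘(ℝ, E4) (𝓡 4) Ψ₀ x v) := by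
  have hε1 : ε < 1 := hεΛ.trans hΛ
  have hεtop : ε ≠ ⊤ := (hε1.trans ENNReal.one_lt_top).ne
  have hdev' : 𝓢.deviationCk (hypBackground U₀) Ψ₀ k 0 ≤ ENNReal.ofReal ε.toReal := by
    rwa [ENNReal.ofReal_toReal hεtop]
  exact 𝓢.le_pullback_of_apply_zero_eq_zero U₀ Ψ₀ k ENNReal.toReal_nonneg hdev' hx hv

end ZeroHoles

/-! ### The registered signature, proved modulo the facts -/

/-- The registered signature of `stub_probeSector`, as a `Prop` (verbatim). [folklore] -/
def ProbeSector : Prop :=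
  ∀ (k : ℕ) (ε : ℝ≥0∞), 0 < ε →
    ∃ k' : ℕ, ∀ Λ : ℝ≥0∞, Λ < 1 → ε < Λ → ∃ γ : ℝ, 0 < γ ∧
    ∀ (X : Type) [TopologicalSpace X] [ChartedSpace E3 X] [IsManifold (𝓡 3) ∞ X]
      [T2Space X] [SecondCountableTopology X] [ConnectedSpace X],
    ∀ D ∈ admissibleVacuumData X, ∀ (𝒟 : VacuumCauchyDevelopment D) (M a : Fin 0 → ℝ)
      (S : Set 𝒟.carrier) (p : 𝒟.carrier),
    𝒟.IsMaximal → 𝒟.toCauchyDevelopment.IsNearKerrLeaf k' Λ 0 M a S → p ∈ S →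
    (∃ m : ℝ, 𝒟.toCauchyDevelopment.HasCutBondiMass ({p} : Set 𝒟.carrier) m) →
    𝒟.BondiBartnikGapLE ({p} : Set 𝒟.carrier) γ →
    ∃ S' : Set 𝒟.carrier, 𝒟.toCauchyDevelopment.IsNearKerrLeaf k ε 0 M a S' ∧
      S' ⊆ 𝒟.metric.causalFuture 𝒟.timeOrientation S

/-- **Route (a), three facts**: B1 → F3 → B2 compose to the probe sector (pure logic: `k'` from F3 at
B2's `k₁`; `γ := min(γ_F3, γ_B2)/2`, `η := γ`; glue `J⁺(S₁) ⊆ J⁺(J⁺{p}) = J⁺{p} ⊆ J⁺(S)`).  The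
hypotheses `Λ < 1`/`ε < Λ` are only passed on. [folklore] -/
theorem probeSector_of_B1_F3_B2 (hB1 : ProbeBartnikMassZero) (hF3 : EscapeWindowLeaf)
    (hB2 : HyperboloidalMassPinchesFlat) : ProbeSector := by
  intro k ε hε
  obtain ⟨k₁, hP⟩ := hB2 k ε hε
  obtain ⟨k', hW⟩ := hF3 k₁
  refine ⟨k', fun Λ hΛ1 _hεΛ => ?_⟩
  obtain ⟨Λ₁, γ₄, hΛ₁, hγ₄, hW'⟩ := hW Λ hΛ1
  obtain ⟨γ₅, hγ₅, hP'⟩ := hP Λ₁ hΛ₁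
  set γs : ℝ := min γ₄ γ₅ with hγs
  have hγs0 : 0 < γs := lt_min hγ₄ hγ₅
  refine ⟨γs / 2, by positivity, ?_⟩
  intro X _ _ _ _ _ _ D hD 𝒟 M a S p hmax hleaf hp _hcut hgap
  -- B1 + gap: an own cut energy ≤ γs
  obtain ⟨m, hm, hmle⟩ := exists_hasCutBondiMass_le_of_gap 𝒟
    (hB1 X D hD 𝒟 p hmax (hleaf.subset_causalFuture hp)) hgap (half_pos hγs0)
  have hmγ : m ≤ γs := by linarith
  -- F3: the honest hyperboloid inside J⁺(p)
  obtain ⟨S₁, hS₁, hS₁p⟩ :=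
    hW' X D hD 𝒟 M a S p m hmax hleaf hp hm (hmγ.trans (min_le_left _ _))
  -- B2: the engine
  obtain ⟨S', hS', hS'S₁⟩ := hP' X D hD 𝒟 M a S₁ p m hmax hS₁ hS₁p hm (hmγ.trans (min_le_right _ _))
  exact ⟨S', hS', subset_causalFuture_of_two_steps 𝒟 hS'S₁ hS₁p hp⟩

/-- **Route (a), two facts (recommended)**: B1 and the SOUND merged fact F_far′ give the probe sector
(`γ := γ_far/2`, `η := γ`; sound ⇒ typed, `IsSoundNearKerrLeaf.isNearKerrLeaf`; `J⁺{p} ⊆ J⁺(S)`).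
[folklore] -/
theorem probeSector_of_B1_sound (hB1 : ProbeBartnikMassZero) (hF : ConeEnergyPinchesFlatSound) :
    ProbeSector := by
  intro k ε hε
  obtain ⟨k', hF'⟩ := hF k ε hε
  refine ⟨k', fun Λ hΛ1 _hεΛ => ?_⟩
  obtain ⟨γ, hγ, hF''⟩ := hF' Λ hΛ1
  refine ⟨γ / 2, by positivity, ?_⟩
  intro X _ _ _ _ _ _ D hD 𝒟 M a S p hmax hleaf hp _hcut hgap
  obtain ⟨m, hm, hmle⟩ := exists_hasCutBondiMass_le_of_gap 𝒟
    (hB1 X D hD 𝒟 p hmax (hleaf.subset_causalFuture hp)) hgap (half_pos hγ)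
  obtain ⟨S', hS', hS'p⟩ := hF'' X D hD 𝒟 M a S p m hmax hleaf hp hm (by linarith)
  exact ⟨S', hS'.isNearKerrLeaf, subset_causalFuture_of_subset_causalFuture_singleton 𝒟 hS'p hp⟩

/-- **For the record**: even the leaf-free F_far⁰ yields the registered signature formally (with
`k' := k`, the hypothesis leaf being used only through `p ∈ S ⊆ J⁺(ι X)`) — which is exactly why F_far⁰
cannot be an honest fact (it ignores the protection the `Λ`-honest leaf provides). [folklore] -/
theorem probeSector_of_B1_farLeaf (hB1 : ProbeBartnikMassZero) (hF : SmallConeEnergyFlatLeaf) :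
    ProbeSector := by
  intro k ε hε
  obtain ⟨γ, hγ, hF'⟩ := hF k ε hε
  refine ⟨k, fun Λ _hΛ1 _hεΛ => ⟨γ / 2, by positivity, ?_⟩⟩
  intro X _ _ _ _ _ _ D hD 𝒟 M a S p hmax hleaf hp _hcut hgap
  have hpJ := hleaf.subset_causalFuture hp
  obtain ⟨m, hm, hmle⟩ := exists_hasCutBondiMass_le_of_gap 𝒟 (hB1 X D hD 𝒟 p hmax hpJ) hgap
    (half_pos hγ)
  obtain ⟨S', hS', hS'p⟩ := hF' X D hD 𝒟 M a p m hmax hpJ hm (by linarith)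
  exact ⟨S', hS', subset_causalFuture_of_subset_causalFuture_singleton 𝒟 hS'p hp⟩

/-- **`stub_probeSector` modulo the two recommended facts**, with the registered signature VERBATIM
(the `def ProbeSector` unfolds definitionally; this is the term to splice in place of the work file's
`sorry` once B1 and F_far′ are theorems). [folklore] -/
theorem stub_probeSector_of_facts (hB1 : ProbeBartnikMassZero) (hF : ConeEnergyPinchesFlatSound) :
    ∀ (k : ℕ) (ε : ℝ≥0∞), 0 < ε →
    ∃ k' : ℕ, ∀ Λ : ℝ≥0∞, Λ < 1 → ε < Λ → ∃ γ : ℝ, 0 < γ ∧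
    ∀ (X : Type) [TopologicalSpace X] [ChartedSpace E3 X] [IsManifold (𝓡 3) ∞ X]
      [T2Space X] [SecondCountableTopology X] [ConnectedSpace X],
    ∀ D ∈ admissibleVacuumData X, ∀ (𝒟 : VacuumCauchyDevelopment D) (M a : Fin 0 → ℝ)
      (S : Set 𝒟.carrier) (p : 𝒟.carrier),
    𝒟.IsMaximal → 𝒟.toCauchyDevelopment.IsNearKerrLeaf k' Λ 0 M a S → p ∈ S →
    (∃ m : ℝ, 𝒟.toCauchyDevelopment.HasCutBondiMass ({p} : Set 𝒟.carrier) m) →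
    𝒟.BondiBartnikGapLE ({p} : Set 𝒟.carrier) γ →
    ∃ S' : Set 𝒟.carrier, 𝒟.toCauchyDevelopment.IsNearKerrLeaf k ε 0 M a S' ∧
      S' ⊆ 𝒟.metric.causalFuture 𝒟.timeOrientation S :=
  probeSector_of_B1_sound hB1 hF

/-! ### Sanity: the Minkowski instance of the conclusion (anti-refutation, audit item (b)) -/

/-- In the Minkowski development the CONCLUSION of the probe sector holds for every hypothesis leaf
`S ∋ p` (indeed for every set `S ∋ p`): a dodging `(ε, k)`-leaf inside `J⁺({p}) ⊆ J⁺(S)`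
(`Minkowski.exists_isNearKerrLeaf_subset_causalFuture_forall_dist_lt`), so no refutation can come from
the only constructible vacuum Cauchy development of the tree. [folklore] -/
theorem minkowski_conclusion (k : ℕ) {ε : ℝ≥0∞} (hε : 0 < ε) (M a : Fin 0 → ℝ) (S : Set E4)
    {p : E4} (hp : p ∈ S) :
    ∃ S' : Set E4, Minkowski.vacuumCauchyDevelopment.toCauchyDevelopment.IsNearKerrLeaf k ε 0 M a S' ∧
      S' ⊆ Minkowski.vacuumCauchyDevelopment.metric.causalFuture
        Minkowski.vacuumCauchyDevelopment.timeOrientation S := by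
  obtain ⟨S', hS', hS'p, -, -⟩ :=
    Minkowski.exists_isNearKerrLeaf_subset_causalFuture_forall_dist_lt k hε p 0 0
  have hM : M = ![] := Subsingleton.elim _ _
  have ha : a = ![] := Subsingleton.elim _ _
  subst hM ha
  exact ⟨S', hS', hS'p.trans (LorentzianMetric.causalFuture_mono (singleton_subset_iff.2 hp))⟩

end ProbeSectorFacts

end Summit.FinalStateConjecture.FinalStateConjecture.Theorems.BondiBartnikRigidity.DirectMethod

end
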